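import Summits.BirchSwinnertonDyer.BirchSwinnertonDyer.Theorems.SignedLowerHalvesSprungLowerDivisibilityAtThreeBothColoursOfTraceFE
import Literature.NumberTheory.EllipticCurves.Sprung2017.TraceCoordinateFunctionalEquationProofs
import HarnessLib

/-!
# Crux `SprungLowerDivisibilityAtThree` (stmt-BirchSwinnertonDyer-19875), line `chromatic-common-zeros`,
# stub S0 `stub_bothColours` UNCONDITIONALLY: BOTH colours `L♯, L♭ ≠ 0` on class X8, CLASS-WIDE
# (any rank, image, level) — Sprung 2017 Conj. 4.12 / 2012 Conj. 6.15 at `(3, ±3)`, a kernel theorem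

Cell `bsd-ssimc` (host) / width seat `cruxlead-stmt-BirchSwinnertonDyer-19875-w3` (gen 2); `--supports`
19875; theorems only. The companion file `…BothColoursOfTraceFE` proved the statement modulo ONE named fact,
the trace-coordinate functional equation `Sprung2017.thm413_traceCoordinate_functionalEquation_three`; that
fact is now a THEOREM (`thm413_traceCoordinate_functionalEquation_three_holds`,
`Literature/NumberTheory/EllipticCurves/Sprung2017/TraceCoordinateFunctionalEquationProofs.lean`: finite-level
Mazur–Tate–Teitelbaum §I.17 with `3`-integral symbols, descent of Sprung's congruences to `Λ`, and the
`3`-adic limit matrix `ℒ(3, ±3)`), so the hypothesis is discharged here.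

What this gives: for EVERY X8 pair `(W, 3)` (good supersingular, `a_3 = ±3`), every newform `f` of `W` and
every Sprung pair `(L♯, L♭)` (`IsSprungPair f 3 a_3 L♯ L♭`): `L♯ ≠ 0 ∧ L♭ ≠ 0` in `Λ = ℤ_3⟦T⟧`
(`ClassX8.sharp_ne_zero_and_flat_ne_zero`); equivalently the crux's guard `chromaticL • L♯ L♭ ≠ 0` holds
for both colours (`ClassX8.chromaticL_ne_zero`). This is the registered v6 stub `stub_bothColours` and, with
its (now idle) positive-rank binder, x8 child C3 `PrintX8VS.ChromaticBothColoursPosRankX8`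
(stmt-BirchSwinnertonDyer-26783). HONEST FRAMING: K1 (`SprungLowerDivisibilityAtThree`) / BSD / leaf X8 are
NOT proved by this; no summit statement is proved.
-/

set_option autoImplicit false

noncomputable section

open scoped MatrixGroups ModularForm

open CongruenceSubgroup WeierstrassCurve
  Literature.NumberTheory.EllipticCurves Literature.NumberTheory.EllipticCurves.ModularForms
  Literature.NumberTheory.EllipticCurves.Sprung2017 Literature.NumberTheory.EllipticCurves.Rank1Residual

namespace Summit.BirchSwinnertonDyer.BirchSwinnertonDyer.Theorems.ChromaticBothColours

/-- **BOTH COLOURS ARE NON-ZERO ON CLASS X8, class-wide and input-free** (Sprung 2017 Conj. 4.12 / Sprung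
2012 Conj. 6.15 at `(p, a_p) = (3, ±3)`): for every X8 pair `(W, 3)`, every newform `f` of `W` and every
Sprung pair `(L♯, L♭)` of `f` at `3`, `L♯ ≠ 0` and `L♭ ≠ 0`. The conditional theorem
`ClassX8.sharp_ne_zero_and_flat_ne_zero_of_traceFE` with its single hypothesis discharged by
`thm413_traceCoordinate_functionalEquation_three_holds`. = registered stub S0 `stub_bothColours` (v6) of
line `chromatic-common-zeros`. [cite: Sprung2017, Conj. 4.12, Thm. 1.1, Thm. 4.13, Cor. 4.14]
[cite: MazurTateTeitelbaum1986Invent, §I.17] -/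
theorem ClassX8.sharp_ne_zero_and_flat_ne_zero :
    ∀ (W : WeierstrassCurve ℚ) [W.IsElliptic] [W.IsGloballyMinimal] (p : ℕ) [Fact p.Prime],
      ClassX8 W p → ∀ (N : ℕ) (_ : NeZero N) (f : CuspForm (Gamma0 N) 2)
        (Lsharp Lflat : IwasawaAlgebra p),
      IsNewformOf W f → IsSprungPair f p (W.frobeniusTrace p) Lsharp Lflat →
      Lsharp ≠ 0 ∧ Lflat ≠ 0 :=
  ClassX8.sharp_ne_zero_and_flat_ne_zero_of_traceFE thm413_traceCoordinate_functionalEquation_three_holds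

/-- **The crux's guard is a theorem on X8**: for every colour `•`, `chromaticL • L♯ L♭ ≠ 0` — the
hypothesis `L^• ≠ 0` of `Theorems.SprungSharpFlatLowerDivisibility W 3 •` is always met on class X8.
[cite: Sprung2017, Conj. 4.12 and Thm. 4.13] -/
theorem ClassX8.chromaticL_ne_zero (W : WeierstrassCurve ℚ) [W.IsElliptic] [W.IsGloballyMinimal] (p : ℕ)
    [Fact p.Prime] (hX : ClassX8 W p) {N : ℕ} [hN : NeZero N] (f : CuspForm (Gamma0 N) 2)
    (Lsharp Lflat : IwasawaAlgebra p) (hf : IsNewformOf W f)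
    (hSP : IsSprungPair f p (W.frobeniusTrace p) Lsharp Lflat) (col : Chroma) :
    chromaticL col Lsharp Lflat ≠ 0 :=
  ClassX8.chromaticL_ne_zero_of_traceFE thm413_traceCoordinate_functionalEquation_three_holds W p hX f
    Lsharp Lflat hf hSP col

/-- **Positive-rank form** (the registered stub S0⁺ / x8 child C3 `PrintX8VS.ChromaticBothColoursPosRankX8`,
stmt-BirchSwinnertonDyer-26783, statement verbatim with its rank binder, which is idle).
[cite: Sprung2017, Conj. 4.12 and Thm. 4.13] -/
theorem ClassX8.sharp_ne_zero_and_flat_ne_zero_of_analyticRank_ne_zero :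
    ∀ (W : WeierstrassCurve ℚ) [W.IsElliptic] [W.IsGloballyMinimal] (p : ℕ) [Fact p.Prime],
      ClassX8 W p → W.analyticRank ≠ 0 → ∀ (N : ℕ) (_ : NeZero N) (f : CuspForm (Gamma0 N) 2)
        (Lsharp Lflat : IwasawaAlgebra p),
      IsNewformOf W f → IsSprungPair f p (W.frobeniusTrace p) Lsharp Lflat →
      Lsharp ≠ 0 ∧ Lflat ≠ 0 :=
  fun W _ _ p _ hX _ N hN f Lsharp Lflat hf hSP =>
    ClassX8.sharp_ne_zero_and_flat_ne_zero W p hX N hN f Lsharp Lflat hf hSP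

end Summit.BirchSwinnertonDyer.BirchSwinnertonDyer.Theorems.ChromaticBothColours

end
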